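import Summits.Ventures.LatticeQCDFlow.Scaling.HubClassChainTransitionLaw

/-!
HONEST FRAMING: exact (Metropolis-corrected) sampling algorithms for lattice gauge theory; figures
of merit are autocorrelation/cost numbers at stated couplings and volumes; no continuum-physics
claim.

# HubClassChainDictionary — THE DICTIONARY TO CHAPTER W MADE A THEOREM: FOR CHAPTER W'S HUB KERNEL `Kh(N;h,v) = (N(v)/K)·min{1,W_h/W_v}` AND ANY ENUMERATION `e` OF THE CONTENTS PRESENT
# IN `N` BY NON-INCREASING PERSISTENCE, THE `n`-STEP HUB-CONTENT LAW IS `Khⁿ(e_i,e_j) = (N(e_j)/W(e_j))·T_n(max(i,j)) + β_iⁿδ_{ij}` WITH THE EXPLICIT `β`, `R`, `T` OF FILES 7–8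
# (lean-2 GEN-39, ours)

Venture-side (OURS).  Cell `lqcd-flow` (pub-lqcd), unit `pub-lqcd-lean-2-g39`, 2026-08-30.  Chapter Y, file 12.  Chapter W pins the within-cycle hub kernel of the lumped star by
`Kh(N;h,v) = 𝟙{N(h) ≠ 0}·(N(v)/K)·acc(h,v)` (`h ≠ v`), `Kh(N;h,h) = 1 − Σ_{v≠h}Kh(N;h,v)`, `acc(h,v) = min{1,W_h/W_v}` (e.g. `FiniteOddsLaw`).  Files 7–8 solved the class chain
`P(i,j) = cN_j·min{1,ρ_j/ρ_i}` on depth ranks.  Here the two are identified: given a composition `N`, an enumeration `e : ℕ → S` of the contents present (`N(e_i) ≠ 0` for `i < m`,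
injective on `[0,m)`, covering `{v : N(v) ≠ 0}`) sorted by non-increasing persistence `W` (= non-decreasing depth `ρ = 1/W`), and the `n`-step kernels `Khⁿ` by their recursion on `S`:

* `dict_Kh_absent`, `dict_sum_present` (sums over `S` of functions vanishing on absent contents are sums over the ranks), `dict_Kh_offdiag` (`Kh(N;e_i,e_j) = (1/K)N(e_j)min{1,ρ_j/ρ_i}`),
  `dict_Kh_diag`, `dict_Khn_absent`, `dict_Khn_succ` (the recursion of `Khⁿ` closes on the ranks);
* **`dict_Khn_offdiag`** ∕ **`dict_Khn_diag`**: with `R_k = Σ_{l<k}N(e_l)/W(e_l)`, `M_k = Σ_{k≤l<m}N(e_l)`, `β_k = 1 − (1/K)(M_k + R_k·W(e_k))`,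
  `T_n(j) = (1−β_jⁿ)/R_m + Σ_{j<k<m}(1/R_k − 1/R_{k+1})(β_kⁿ − β_jⁿ)` (hypothesis-equations on the ranks `< m` ∕ `≤ m` only):
  `Khⁿ(N;e_i,e_j) = (N(e_j)/W(e_j))·T_n(max(i,j))` for `i ≠ j` and `Khⁿ(N;e_j,e_j) = (N(e_j)/W(e_j))·T_n(j) + β_jⁿ` — the `j`-attempt hub-content laws `x_j(c) = Khʲ(N; z, c)` of chapter W's
  criterion in closed form.

The proof builds the `ℕ`-indexed objects of files 7–8 (depths extended constantly beyond the top rank, unit weights there, the kernel extended by its formula) inside, so that the user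
supplies nothing but `Kh`, `N`, `e` and the displayed formulas.  Literature grade (cell rule): OWN, plumbing; nothing cited; no new bib keys.
-/

open Finset

namespace Summit.Ventures.LatticeQCDFlow.Scaling

section Dict
variable {S : Type*} [Fintype S] [DecidableEq S]
variable {W : S → ℝ} {acc : S → S → ℝ} {Kh : (S → ℕ) → S → S → ℝ} {K : ℕ} {N : S → ℕ} {e : ℕ → S} {m : ℕ} {Khn : ℕ → S → S → ℝ}

omit [Fintype S] [DecidableEq S] in
/-- Absent contents are not reached in one step: `N(v) = 0`, `v ≠ h` ⇒ `Kh(N;h,v) = 0`. [ours] -/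
theorem dict_Kh_absent (hKoff : ∀ N h v, h ≠ v → Kh N h v = if N h = 0 then 0 else (N v : ℝ) / K * acc h v) {h v : S} (hv : N v = 0) (hhv : h ≠ v) :
    Kh N h v = 0 := by
  rw [hKoff N h v hhv]; split_ifs
  · rfl
  · rw [hv]; simp

/-- **Sums over `S` of functions vanishing on absent contents are sums over the ranks.** [ours] -/
theorem dict_sum_present (he_inj : ∀ i j, i < m → j < m → e i = e j → i = j) (he_cov : ∀ v, N v ≠ 0 → ∃ i, i < m ∧ e i = v)
    {F : S → ℝ} (hF : ∀ v, N v = 0 → F v = 0) : ∑ v, F v = ∑ j ∈ range m, F (e j) := by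
  classical
  have hinj : Set.InjOn e ↑(range m) := fun i hi j hj h => he_inj i j (mem_range.mp hi) (mem_range.mp hj) h
  rw [← Finset.sum_image (f := F) (s := range m) (g := e) (fun i hi j hj h => hinj hi hj h)]
  symm
  refine Finset.sum_subset (subset_univ _) fun v _ hv => hF v ?_
  by_contra hN
  obtain ⟨i, hi, rfl⟩ := he_cov v hN
  exact hv (mem_image.mpr ⟨i, mem_range.mpr hi, rfl⟩)

/-- The erased version: for `i < m`, `Σ_{v ≠ e_i}F(v) = Σ_{j<m, j≠i}F(e_j)`. [ours] -/
theorem dict_sum_present_erase (he_inj : ∀ i j, i < m → j < m → e i = e j → i = j) (he_cov : ∀ v, N v ≠ 0 → ∃ i, i < m ∧ e i = v)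
    {F : S → ℝ} (hF : ∀ v, N v = 0 → F v = 0) {i : ℕ} (hi : i < m) : ∑ v ∈ univ.erase (e i), F v = ∑ j ∈ (range m).erase i, F (e j) := by
  rw [Finset.sum_erase_eq_sub (mem_univ _), Finset.sum_erase_eq_sub (mem_range.mpr hi), dict_sum_present he_inj he_cov hF]

omit [Fintype S] [DecidableEq S] in
/-- **Off the diagonal `Kh` is the class chain:** `Kh(N;e_i,e_j) = (1/K)·N(e_j)·min{1, ρ_j/ρ_i}` with `ρ = 1/W`, for `i ≠ j` below `m`. [ours] -/
theorem dict_Kh_offdiag (hW : ∀ v, 0 < W v) (hacc : ∀ h v, acc h v = min 1 (W h / W v))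
    (hKoff : ∀ N h v, h ≠ v → Kh N h v = if N h = 0 then 0 else (N v : ℝ) / K * acc h v)
    (he_inj : ∀ i j, i < m → j < m → e i = e j → i = j) (he_pres : ∀ i, i < m → N (e i) ≠ 0)
    {i j : ℕ} (hi : i < m) (hj : j < m) (hij : i ≠ j) :
    Kh N (e i) (e j) = 1 / K * N (e j) * min 1 ((1 / W (e j)) / (1 / W (e i))) := by
  have hne : e i ≠ e j := fun h => hij (he_inj i j hi hj h)
  rw [hKoff N (e i) (e j) hne, if_neg (he_pres i hi), hacc]
  have : (1 / W (e j)) / (1 / W (e i)) = W (e i) / W (e j) := by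
    have h1 := (hW (e i)).ne'; have h2 := (hW (e j)).ne'; field_simp
  rw [this]; ring

/-- **The diagonal closes on the ranks:** `Kh(N;e_i,e_i) = 1 − Σ_{j<m, j≠i}Kh(N;e_i,e_j)` for `i < m`. [ours] -/
theorem dict_Kh_diag (hKoff : ∀ N h v, h ≠ v → Kh N h v = if N h = 0 then 0 else (N v : ℝ) / K * acc h v)
    (hKdiag : ∀ N h, Kh N h h = 1 - ∑ v ∈ univ.erase h, Kh N h v)
    (he_inj : ∀ i j, i < m → j < m → e i = e j → i = j) (he_pres : ∀ i, i < m → N (e i) ≠ 0) (he_cov : ∀ v, N v ≠ 0 → ∃ i, i < m ∧ e i = v)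
    {i : ℕ} (hi : i < m) : Kh N (e i) (e i) = 1 - ∑ j ∈ (range m).erase i, Kh N (e i) (e j) := by
  rw [hKdiag, dict_sum_present_erase he_inj he_cov (fun v hv => ?_) hi]
  by_cases h : e i = v
  · exact absurd (h ▸ hv) (he_pres i hi)
  · exact dict_Kh_absent hKoff hv h

/-- From a present start the `n`-step kernel never charges an absent content. [ours] -/
theorem dict_Khn_absent (hKoff : ∀ N h v, h ≠ v → Kh N h v = if N h = 0 then 0 else (N v : ℝ) / K * acc h v)
    (he_pres : ∀ i, i < m → N (e i) ≠ 0)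
    (hKhn0 : ∀ h v, Khn 0 h v = if h = v then 1 else 0) (hKhns : ∀ n h v, Khn (n + 1) h v = ∑ w, Khn n h w * Kh N w v)
    (n : ℕ) {i : ℕ} (hi : i < m) {w : S} (hw : N w = 0) : Khn n (e i) w = 0 := by
  induction n generalizing w with
  | zero =>
      rw [hKhn0]
      split_ifs with h
      · exact absurd (h ▸ hw) (he_pres i hi)
      · rfl
  | succ n ih =>
      rw [hKhns]
      refine sum_eq_zero fun w' _ => ?_
      by_cases hw' : N w' = 0
      · rw [ih hw', zero_mul]
      · have : w' ≠ w := fun h => hw' (h ▸ hw)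
        rw [dict_Kh_absent hKoff hw this, mul_zero]

/-- **The recursion of `Khⁿ` closes on the ranks:** `Khⁿ⁺¹(e_i,e_j) = Σ_{l<m}Khⁿ(e_i,e_l)Kh(e_l,e_j)` for `i, j < m`. [ours] -/
theorem dict_Khn_succ (hKoff : ∀ N h v, h ≠ v → Kh N h v = if N h = 0 then 0 else (N v : ℝ) / K * acc h v)
    (he_inj : ∀ i j, i < m → j < m → e i = e j → i = j) (he_pres : ∀ i, i < m → N (e i) ≠ 0) (he_cov : ∀ v, N v ≠ 0 → ∃ i, i < m ∧ e i = v)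
    (hKhn0 : ∀ h v, Khn 0 h v = if h = v then 1 else 0) (hKhns : ∀ n h v, Khn (n + 1) h v = ∑ w, Khn n h w * Kh N w v)
    (n : ℕ) {i j : ℕ} (hi : i < m) (hj : j < m) :
    Khn (n + 1) (e i) (e j) = ∑ l ∈ range m, Khn n (e i) (e l) * Kh N (e l) (e j) := by
  have _ := hj
  rw [hKhns]
  exact dict_sum_present he_inj he_cov fun w hw => by rw [dict_Khn_absent hKoff he_pres hKhn0 hKhns n hi hw, zero_mul]

/-- The internal `ℕ`-indexed class chain built from `Kh`, `N`, `e` (depths `1/W` extended constantly beyond the top rank, unit weights there, the kernel extended by its formula, powers by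
recursion on the ranks) satisfies the hypotheses of files 7–8 and agrees with `Khⁿ` on the ranks.  Packaged as one statement: the Smith–Tierney form for `Khⁿ`. -/
theorem dict_Khn_form (hW : ∀ v, 0 < W v) (hacc : ∀ h v, acc h v = min 1 (W h / W v)) (hK : 1 ≤ K)
    (hKoff : ∀ N h v, h ≠ v → Kh N h v = if N h = 0 then 0 else (N v : ℝ) / K * acc h v)
    (hKdiag : ∀ N h, Kh N h h = 1 - ∑ v ∈ univ.erase h, Kh N h v)
    (he_inj : ∀ i j, i < m → j < m → e i = e j → i = j) (he_pres : ∀ i, i < m → N (e i) ≠ 0) (he_cov : ∀ v, N v ≠ 0 → ∃ i, i < m ∧ e i = v)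
    (hsorted : ∀ i j, i ≤ j → j < m → W (e j) ≤ W (e i))
    (hKhn0 : ∀ h v, Khn 0 h v = if h = v then 1 else 0) (hKhns : ∀ n h v, Khn (n + 1) h v = ∑ w, Khn n h w * Kh N w v)
    {R M β : ℕ → ℝ} {T : ℕ → ℕ → ℝ}
    (hR : ∀ k, k ≤ m → R k = ∑ l ∈ range k, (N (e l) : ℝ) / W (e l)) (hM : ∀ k, k ≤ m → M k = ∑ l ∈ Ico k m, (N (e l) : ℝ))
    (hβ : ∀ k, k < m → β k = 1 - 1 / K * (M k + R k * W (e k)))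
    (hT : ∀ n j, j < m → T n j = (1 - β j ^ n) / R m + ∑ k ∈ Ico (j + 1) m, (1 / R k - 1 / R (k + 1)) * (β k ^ n - β j ^ n))
    (n : ℕ) {i j : ℕ} (hi : i < m) (hj : j < m) :
    (i ≠ j → Khn n (e i) (e j) = (N (e j) : ℝ) / W (e j) * T n (max i j)) ∧ (i = j → Khn n (e i) (e j) = (N (e j) : ℝ) / W (e j) * T n j + β j ^ n) := by
  classical
  have hm : 1 ≤ m := by omega
  -- the extended depth profile and weights on all of `ℕ`
  let ρ' : ℕ → ℝ := fun l => 1 / W (e (min l (m - 1)))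
  let N' : ℕ → ℝ := fun l => if l < m then (N (e l) : ℝ) else 1
  have hρ'eq : ∀ l, l < m → ρ' l = 1 / W (e l) := fun l hl => by simp only [ρ']; rw [min_eq_left (by omega)]
  have hN'eq : ∀ l, l < m → N' l = (N (e l) : ℝ) := fun l hl => by simp only [N']; rw [if_pos hl]
  have hρ' : ∀ l, 0 < ρ' l := fun l => by simp only [ρ']; exact div_pos one_pos (hW _)
  have hN' : ∀ l, 0 < N' l := by
    intro l; simp only [N']; split_ifs with h
    · exact_mod_cast Nat.pos_of_ne_zero (he_pres l h)
    · exact one_pos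
  have hmono' : Monotone ρ' := by
    intro a b hab
    simp only [ρ']
    exact one_div_le_one_div_of_le (hW _) (hsorted _ _ (min_le_min hab le_rfl) (by omega))
  let c : ℝ := 1 / K
  have hc : 0 ≤ c := by simp only [c]; positivity
  let R' : ℕ → ℝ := fun k => ∑ l ∈ range k, N' l * ρ' l
  let M' : ℕ → ℝ := fun k => ∑ l ∈ Ico k m, N' l
  let β' : ℕ → ℝ := fun k => 1 - c * (M' k + R' k / ρ' k)
  let f' : ℕ → ℕ → ℝ := fun k l => if l < k then ρ' k else if l = k then -(R' k / N' k) else 0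
  let T' : ℕ → ℕ → ℝ := fun n j => (1 - β' j ^ n) / R' m + ∑ k ∈ Ico (j + 1) m, (1 / R' k - 1 / R' (k + 1)) * (β' k ^ n - β' j ^ n)
  let Q : ℕ → ℕ → ℝ := fun a b => if a < m ∧ b < m then Kh N (e a) (e b) else c * N' b * min 1 (ρ' b / ρ' a)
  let P' : ℕ → ℕ → ℝ := fun a b => if a = b then 1 - ∑ l ∈ (range m).erase a, Q a l else Q a b
  let Pn' : ℕ → ℕ → ℕ → ℝ := fun n => Nat.rec (fun a b => if a = b then (1:ℝ) else 0) (fun _ Mx => fun a b => ∑ l ∈ range m, Mx a l * P' l b) n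
  -- agreement of the auxiliary objects with the user's data on the ranks
  have hR'eq : ∀ k, k ≤ m → R' k = R k := by
    intro k hk; rw [hR k hk]; simp only [R']
    exact sum_congr rfl fun l hl => by have := mem_range.mp hl; rw [hN'eq l (by omega), hρ'eq l (by omega)]; ring
  have hM'eq : ∀ k, k ≤ m → M' k = M k := by
    intro k hk; rw [hM k hk]; simp only [M']
    exact sum_congr rfl fun l hl => by have := (mem_Ico.mp hl).2; rw [hN'eq l this]
  have hβ'eq : ∀ k, k < m → β' k = β k := by
    intro k hk; rw [hβ k hk]; simp only [β']; rw [hM'eq k hk.le, hR'eq k hk.le, hρ'eq k hk]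
    have := (hW (e k)).ne'; simp only [c]; field_simp
  have hT'eq : ∀ n j, j < m → T' n j = T n j := by
    intro n j hj; rw [hT n j hj]; simp only [T']; rw [hβ'eq j hj, hR'eq m le_rfl]
    congr 1
    exact sum_congr rfl fun k hk => by
      have hk' := mem_Ico.mp hk
      rw [hR'eq k (by omega), hR'eq (k + 1) (by omega), hβ'eq k hk'.2]
  -- the class-chain hypotheses for `P'`
  have hQ_in : ∀ a b, a < m → b < m → Q a b = Kh N (e a) (e b) := fun a b ha hb => if_pos ⟨ha, hb⟩
  have hQ_out : ∀ a b, ¬ (a < m ∧ b < m) → Q a b = c * N' b * min 1 (ρ' b / ρ' a) := fun a b h => if_neg h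
  have hP'off : ∀ a b, a ≠ b → P' a b = Q a b := fun a b hab => if_neg hab
  have hP'on : ∀ a, P' a a = 1 - ∑ l ∈ (range m).erase a, Q a l := fun a => if_pos rfl
  have hPoff' : ∀ a b, a ≠ b → P' a b = c * N' b * min 1 (ρ' b / ρ' a) := by
    intro a b hab
    rw [hP'off a b hab]
    by_cases h : a < m ∧ b < m
    · rw [hQ_in a b h.1 h.2, dict_Kh_offdiag hW hacc hKoff he_inj he_pres h.1 h.2 hab, hN'eq b h.2, hρ'eq a h.1, hρ'eq b h.2]
    · exact hQ_out a b h
  have hPdiag' : ∀ a, P' a a = 1 - ∑ l ∈ (range m).erase a, P' a l := by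
    intro a; rw [hP'on a]
    congr 1
    exact sum_congr rfl fun l hl => by rw [hP'off a l (ne_of_mem_erase hl).symm]
  have hP'Kh : ∀ a b, a < m → b < m → P' a b = Kh N (e a) (e b) := by
    intro a b ha hb
    by_cases hab : a = b
    · subst hab
      rw [hPdiag' a, dict_Kh_diag hKoff hKdiag he_inj he_pres he_cov ha]
      congr 1
      exact sum_congr rfl fun l hl => by
        have hl' : l < m := mem_range.mp (mem_of_mem_erase hl)
        rw [hP'off a l (ne_of_mem_erase hl).symm, hQ_in a l ha hl']
    · rw [hP'off a b hab, hQ_in a b ha hb]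
  -- the powers of `P'` on the ranks are `Khⁿ`
  have hPn'Kh : ∀ n a b, a < m → b < m → Pn' n a b = Khn n (e a) (e b) := by
    intro n
    induction n with
    | zero =>
        intro a b ha hb
        show (if a = b then (1:ℝ) else 0) = Khn 0 (e a) (e b)
        rw [hKhn0]
        by_cases hab : a = b
        · rw [if_pos hab, if_pos (by rw [hab])]
        · rw [if_neg hab, if_neg (fun h => hab (he_inj a b ha hb h))]
    | succ n ih =>
        intro a b ha hb
        show ∑ l ∈ range m, Pn' n a l * P' l b = Khn (n + 1) (e a) (e b)
        rw [dict_Khn_succ hKoff he_inj he_pres he_cov hKhn0 hKhns n ha hb]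
        exact sum_congr rfl fun l hl => by rw [ih a l ha (mem_range.mp hl), hP'Kh l b (mem_range.mp hl) hb]
  -- apply file 8
  have hR'h : ∀ k, R' k = ∑ l ∈ range k, N' l * ρ' l := fun _ => rfl
  have hM'h : ∀ k, M' k = ∑ l ∈ Ico k m, N' l := fun _ => rfl
  have hβ'h : ∀ k, β' k = 1 - c * (M' k + R' k / ρ' k) := fun _ => rfl
  have hf'h : ∀ k l, f' k l = if l < k then ρ' k else if l = k then -(R' k / N' k) else 0 := fun _ _ => rfl
  have hT'h : ∀ n j, T' n j = (1 - β' j ^ n) / R' m + ∑ k ∈ Ico (j + 1) m, (1 / R' k - 1 / R' (k + 1)) * (β' k ^ n - β' j ^ n) := fun _ _ => rfl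
  have hP0' : ∀ a b, Pn' 0 a b = if a = b then 1 else 0 := fun _ _ => rfl
  have hPs' : ∀ n a b, Pn' (n + 1) a b = ∑ l ∈ range m, Pn' n a l * P' l b := fun _ _ _ => rfl
  refine ⟨fun hij => ?_, fun hij => ?_⟩
  · have h := hubClass_pow_offdiag hρ' hmono' hN' hR'h hM'h hPoff' hPdiag' hf'h hβ'h hP0' hPs' hT'h n hi hj hij
    rw [hPn'Kh n i j hi hj, hN'eq j hj, hρ'eq j hj, hT'eq n _ (max_lt hi hj)] at h
    rw [h]; ring
  · subst hij
    have h := hubClass_pow_diag hρ' hmono' hN' hR'h hM'h hPoff' hPdiag' hf'h hβ'h hP0' hPs' hT'h n hi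
    rw [hPn'Kh n i i hi hi, hN'eq i hi, hρ'eq i hi, hT'eq n i hi, hβ'eq i hi] at h
    rw [h]; ring

/-- **THE `j`-ATTEMPT HUB-CONTENT LAW OF CHAPTER W IN CLOSED FORM, off the diagonal:** `Khⁿ(N;e_i,e_j) = (N(e_j)/W(e_j))·T_n(max(i,j))` for present ranks `i ≠ j`. [ours] -/
theorem dict_Khn_offdiag (hW : ∀ v, 0 < W v) (hacc : ∀ h v, acc h v = min 1 (W h / W v)) (hK : 1 ≤ K)
    (hKoff : ∀ N h v, h ≠ v → Kh N h v = if N h = 0 then 0 else (N v : ℝ) / K * acc h v)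
    (hKdiag : ∀ N h, Kh N h h = 1 - ∑ v ∈ univ.erase h, Kh N h v)
    (he_inj : ∀ i j, i < m → j < m → e i = e j → i = j) (he_pres : ∀ i, i < m → N (e i) ≠ 0) (he_cov : ∀ v, N v ≠ 0 → ∃ i, i < m ∧ e i = v)
    (hsorted : ∀ i j, i ≤ j → j < m → W (e j) ≤ W (e i))
    (hKhn0 : ∀ h v, Khn 0 h v = if h = v then 1 else 0) (hKhns : ∀ n h v, Khn (n + 1) h v = ∑ w, Khn n h w * Kh N w v)
    {R M β : ℕ → ℝ} {T : ℕ → ℕ → ℝ}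
    (hR : ∀ k, k ≤ m → R k = ∑ l ∈ range k, (N (e l) : ℝ) / W (e l)) (hM : ∀ k, k ≤ m → M k = ∑ l ∈ Ico k m, (N (e l) : ℝ))
    (hβ : ∀ k, k < m → β k = 1 - 1 / K * (M k + R k * W (e k)))
    (hT : ∀ n j, j < m → T n j = (1 - β j ^ n) / R m + ∑ k ∈ Ico (j + 1) m, (1 / R k - 1 / R (k + 1)) * (β k ^ n - β j ^ n))
    (n : ℕ) {i j : ℕ} (hi : i < m) (hj : j < m) (hij : i ≠ j) : Khn n (e i) (e j) = (N (e j) : ℝ) / W (e j) * T n (max i j) :=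
  (dict_Khn_form hW hacc hK hKoff hKdiag he_inj he_pres he_cov hsorted hKhn0 hKhns hR hM hβ hT n hi hj).1 hij

/-- **THE `j`-ATTEMPT HUB-CONTENT LAW OF CHAPTER W IN CLOSED FORM, on the diagonal:** `Khⁿ(N;e_j,e_j) = (N(e_j)/W(e_j))·T_n(j) + β_jⁿ`. [ours] -/
theorem dict_Khn_diag (hW : ∀ v, 0 < W v) (hacc : ∀ h v, acc h v = min 1 (W h / W v)) (hK : 1 ≤ K)
    (hKoff : ∀ N h v, h ≠ v → Kh N h v = if N h = 0 then 0 else (N v : ℝ) / K * acc h v)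
    (hKdiag : ∀ N h, Kh N h h = 1 - ∑ v ∈ univ.erase h, Kh N h v)
    (he_inj : ∀ i j, i < m → j < m → e i = e j → i = j) (he_pres : ∀ i, i < m → N (e i) ≠ 0) (he_cov : ∀ v, N v ≠ 0 → ∃ i, i < m ∧ e i = v)
    (hsorted : ∀ i j, i ≤ j → j < m → W (e j) ≤ W (e i))
    (hKhn0 : ∀ h v, Khn 0 h v = if h = v then 1 else 0) (hKhns : ∀ n h v, Khn (n + 1) h v = ∑ w, Khn n h w * Kh N w v)
    {R M β : ℕ → ℝ} {T : ℕ → ℕ → ℝ}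
    (hR : ∀ k, k ≤ m → R k = ∑ l ∈ range k, (N (e l) : ℝ) / W (e l)) (hM : ∀ k, k ≤ m → M k = ∑ l ∈ Ico k m, (N (e l) : ℝ))
    (hβ : ∀ k, k < m → β k = 1 - 1 / K * (M k + R k * W (e k)))
    (hT : ∀ n j, j < m → T n j = (1 - β j ^ n) / R m + ∑ k ∈ Ico (j + 1) m, (1 / R k - 1 / R (k + 1)) * (β k ^ n - β j ^ n))
    (n : ℕ) {j : ℕ} (hj : j < m) : Khn n (e j) (e j) = (N (e j) : ℝ) / W (e j) * T n j + β j ^ n :=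
  (dict_Khn_form hW hacc hK hKoff hKdiag he_inj he_pres he_cov hsorted hKhn0 hKhns hR hM hβ hT n hj hj).2 rfl

end Dict

end Summit.Ventures.LatticeQCDFlow.Scaling
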